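import Summits.NavierStokesRegularity.FunctionalMining.HsEnergyInequalities
import Summits.NavierStokesRegularity.FunctionalMining.LatticeTrilinear
import Literature.Analysis.FluidPDE.StokesTorusConvectionMode
import Literature.Analysis.FunctionSpaces.TorusTruncationH1
import HarnessLib

/-!
# FunctionalMining — the inertial rate `N_s` of the `Ḣˢ` energy through three Sobolev energies

Search for candidate a priori estimates; no regularity claim. Cell `pub-nsfunc`, prove seat
(gen 12). Fourth file of the static half of the rows `EF.s | T_LD | G1`: the lattice trilinear
estimate (`LatticeTrilinear.sq_tsum_tsum_conv_mul_le`) applied to the inertial rate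
`N_s(v) = −2∫⟪(-Δ)^s v, (v·∇)v⟫` (`hsInertialRate`) of a smooth zero-mean field on `T³`:

**`N_s(v)² ≤ C · E_{t₁+1}(v) · E_{t₂}(v) · E_{t₃+2s}(v)`** (`sq_hsInertialRate_le_trilinear`)

for all `t₁, t₂, t₃ < 3/2` with `t₁ + t₂ + t₃ = 3/2` (and `s > 0`, `t₁ + 1, t₂, t₃ + 2s ≥ 0` so that
the three energies are the spectral sums `E_t = ∑ σ_t ‖v̂‖²`). Ingredients: the Parseval form of the
pairing (`Torus.integral_inner_fracLaplacian_eq_tsum`), the Fourier majorant of the convective term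
`‖𝓕((v·∇)v)(k)‖ ≤ d² ∑_j σ_{1/2}(k−j) ‖v̂(k−j)‖ ‖v̂(j)‖` (coefficients of a product are dominated by
the convolution of the coefficients, `Torus.enorm_mFourierCoeff_inner_mul_apply_le`, and
`𝓕(∂ᵢv)(m) = 2πi mᵢ v̂(m)`), and the trilinear estimate with `a = σ_{1/2}‖v̂‖`, `b = ‖v̂‖`,
`c = σ_s‖v̂‖`. The row bookkeeping (choice of `tᵢ` and interpolation) is in the next file.
-/

noncomputable section

open MeasureTheory Set Filter Topology Function UnitAddTorus
open scoped InnerProductSpace RealInnerProductSpace ENNReal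

namespace Summit.NavierStokesRegularity.FunctionalMining

open Literature.Analysis Literature.Analysis.FunctionSpaces Literature.Analysis.FluidPDE
open Literature.Analysis.FunctionSpaces.Torus Literature.Analysis.FluidPDE.Torus

variable {d : Type*} [Fintype d] [DecidableEq d]

/-! ## 1. Fourier coefficients of derivatives -/

omit [DecidableEq d] in
/-- `|2π mᵢ| ≤ σ_{1/2}(m) = 2π|m|`. [folklore] -/
theorem norm_two_pi_I_mul_le (m : d → ℤ) (i : d) :
    ‖(2 * Real.pi * Complex.I * (m i : ℂ))‖ ≤ fracSymbol (1 / 2) m := by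
  have hf : ((m i : ℝ)) ^ 2 ≤ freqNormSq m :=
    Finset.single_le_sum (f := fun j => ((m j : ℝ)) ^ 2) (fun j _ => sq_nonneg _) (Finset.mem_univ i)
  have h1 : |(m i : ℝ)| ≤ Real.sqrt (freqNormSq m) := by
    rw [← Real.sqrt_sq_eq_abs]; exact Real.sqrt_le_sqrt hf
  have hσ : fracSymbol (1 / 2) m = 2 * Real.pi * Real.sqrt (freqNormSq m) := by
    rw [fracSymbol, ← Real.sqrt_eq_rpow, show 4 * Real.pi ^ 2 * freqNormSq m = (2 * Real.pi) ^ 2 * freqNormSq m by ring,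
      Real.sqrt_mul (by positivity), Real.sqrt_sq (by positivity)]
  rw [hσ, norm_mul, norm_mul, norm_mul, Complex.norm_I, mul_one, Complex.norm_intCast, Complex.norm_real,
    Real.norm_eq_abs, abs_of_pos Real.pi_pos, Complex.norm_ofNat]
  exact mul_le_mul_of_nonneg_left h1 (by positivity)

/-- **`‖𝓕(∂ᵢv)(m)‖ ≤ σ_{1/2}(m) ‖v̂(m)‖`** for a smooth real vector field (`𝓕(∂ᵢv)(m) = 2πi mᵢ v̂(m)`).
[folklore] -/
theorem enorm_mFourierCoeff_partialDeriv_le {v : UnitAddTorus d → EuclideanSpace ℝ d} (hv : IsSmooth v)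
    (i : d) (m : d → ℤ) :
    ‖mFourierCoeff (EuclideanSpace.complexify ∘ Torus.partialDeriv i v) m‖ₑ ≤
      ENNReal.ofReal (fracSymbol (1 / 2) m) * ‖mFourierCoeff (EuclideanSpace.complexify ∘ v) m‖ₑ := by
  rw [mFourierCoeff_complexify_partialDeriv hv i m, enorm_smul, ← ofReal_norm]
  exact mul_le_mul' (ENNReal.ofReal_le_ofReal (norm_two_pi_I_mul_le m i)) le_rfl

/-! (The zero mode of a zero-mean field vanishes: tree lemma
`Torus.mFourierCoeff_complexify_eq_zero_of_hasZeroMean`, `TorusTruncationH1`.) -/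

/-! ## 2. The Fourier majorant of the convective term -/

omit [DecidableEq d] in
/-- `ℓ² ≤ ℓ¹` in `ℂ^d`: `‖x‖ₑ ≤ ∑ₗ ‖xₗ‖ₑ`. [folklore] -/
theorem enorm_le_sum_enorm_apply (x : EuclideanSpace ℂ d) : ‖x‖ₑ ≤ ∑ l, ‖x l‖ₑ := by
  classical
  have hreal : ‖x‖ ≤ ∑ l, ‖x l‖ := by
    conv_lhs => rw [← (EuclideanSpace.basisFun d ℂ).sum_repr x]
    refine (norm_sum_le _ _).trans (Finset.sum_le_sum fun l _ => ?_)
    rw [EuclideanSpace.basisFun_repr, EuclideanSpace.basisFun_apply, norm_smul, PiLp.norm_single,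
      norm_one, mul_one]
  rw [← ofReal_norm, ← Finset.sum_congr rfl fun l _ => (ofReal_norm (x l))]
  rw [← ENNReal.ofReal_sum_of_nonneg fun l _ => norm_nonneg _]
  exact ENNReal.ofReal_le_ofReal hreal

/-- The coordinates of the convective term: `((v·∇)v)ₗ = ∑ᵢ ⟪eᵢ, v⟫ (∂ᵢv)ₗ`. [folklore] -/
theorem convect_apply_eq_sum {v : UnitAddTorus d → EuclideanSpace ℝ d} (hv : IsSmooth v)
    (x : UnitAddTorus d) (l : d) :
    Torus.convect v v x l = ∑ i, ⟪EuclideanSpace.single i (1 : ℝ), v x⟫_ℝ * Torus.partialDeriv i v x l := by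
  unfold Torus.convect
  rw [Torus.fderiv_apply_eq_sum_partialDeriv (hv.isContDiff (by simp)) x (v x), WithLp.ofLp_sum,
    Finset.sum_apply]
  refine Finset.sum_congr rfl fun i _ => ?_
  rw [EuclideanSpace.inner_single_left, map_one, one_mul, WithLp.ofLp_smul, Pi.smul_apply, smul_eq_mul]

/-- **Fourier majorant of the convective term, coordinatewise**:
`‖𝓕((v·∇)v)(k)ₗ‖ ≤ d · ∑_j σ_{1/2}(k−j) ‖v̂(k−j)‖ ‖v̂(j)‖`. [folklore] -/
theorem enorm_mFourierCoeff_convect_apply_le {v : UnitAddTorus d → EuclideanSpace ℝ d} (hv : IsSmooth v)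
    (k : d → ℤ) (l : d) :
    ‖mFourierCoeff (EuclideanSpace.complexify ∘ Torus.convect v v) k l‖ₑ ≤
      (Fintype.card d : ℝ≥0∞) * ∑' j, ENNReal.ofReal (fracSymbol (1 / 2) (k - j)) *
        ‖mFourierCoeff (EuclideanSpace.complexify ∘ v) (k - j)‖ₑ *
        ‖mFourierCoeff (EuclideanSpace.complexify ∘ v) j‖ₑ := by
  have hw : IsSmooth (Torus.convect v v) := hv.convect hv
  rw [mFourierCoeff_complexify_apply hw.integrable k l]
  have hfun : (fun x => ((Torus.convect v v x l : ℝ) : ℂ)) =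
      fun x => ∑ i, (((⟪EuclideanSpace.single i (1 : ℝ), v x⟫_ℝ * Torus.partialDeriv i v x l : ℝ)) : ℂ) := by
    funext x
    rw [convect_apply_eq_sum hv x l, Complex.ofReal_sum]
  have hint : ∀ i ∈ (Finset.univ : Finset d), Integrable
      (fun x => (((⟪EuclideanSpace.single i (1 : ℝ), v x⟫_ℝ * Torus.partialDeriv i v x l : ℝ)) : ℂ)) volume := by
    intro i _
    refine (Complex.continuous_ofReal.comp ?_).integrable_unitAddTorus
    exact (continuous_const.inner hv.continuous).mul
      ((EuclideanSpace.proj l).continuous.comp (hv.partialDeriv i).continuous)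
  rw [hfun, Torus.mFourierCoeff_finset_sum Finset.univ hint k]
  refine (enorm_sum_le _ _).trans ?_
  have hterm : ∀ i, ‖mFourierCoeff
      (fun x => (((⟪EuclideanSpace.single i (1 : ℝ), v x⟫_ℝ * Torus.partialDeriv i v x l : ℝ)) : ℂ)) k‖ₑ ≤
      ∑' j, ENNReal.ofReal (fracSymbol (1 / 2) (k - j)) *
        ‖mFourierCoeff (EuclideanSpace.complexify ∘ v) (k - j)‖ₑ *
        ‖mFourierCoeff (EuclideanSpace.complexify ∘ v) j‖ₑ := by
    intro i
    have h := enorm_mFourierCoeff_inner_mul_apply_le (hv.memLp 2) ((hv.partialDeriv i).memLp 2)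
      (EuclideanSpace.single i (1 : ℝ)) k l
    rw [PiLp.norm_single, norm_one, ENNReal.ofReal_one, one_mul] at h
    refine h.trans (ENNReal.tsum_le_tsum fun j => ?_)
    exact mul_le_mul' (enorm_mFourierCoeff_partialDeriv_le hv i (k - j)) le_rfl
  calc ∑ i, ‖mFourierCoeff
        (fun x => (((⟪EuclideanSpace.single i (1 : ℝ), v x⟫_ℝ * Torus.partialDeriv i v x l : ℝ)) : ℂ)) k‖ₑ
      ≤ ∑ _i : d, ∑' j, ENNReal.ofReal (fracSymbol (1 / 2) (k - j)) *
          ‖mFourierCoeff (EuclideanSpace.complexify ∘ v) (k - j)‖ₑ *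
          ‖mFourierCoeff (EuclideanSpace.complexify ∘ v) j‖ₑ := Finset.sum_le_sum fun i _ => hterm i
    _ = _ := by rw [Finset.sum_const, Finset.card_univ, nsmul_eq_mul]

/-- **Fourier majorant of the convective term**:
`‖𝓕((v·∇)v)(k)‖ ≤ d² · ∑_j σ_{1/2}(k−j) ‖v̂(k−j)‖ ‖v̂(j)‖` for a smooth real vector field on `T^d`.
[folklore] -/
theorem enorm_mFourierCoeff_convect_le {v : UnitAddTorus d → EuclideanSpace ℝ d} (hv : IsSmooth v)
    (k : d → ℤ) :
    ‖mFourierCoeff (EuclideanSpace.complexify ∘ Torus.convect v v) k‖ₑ ≤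
      (Fintype.card d : ℝ≥0∞) ^ 2 * ∑' j, ENNReal.ofReal (fracSymbol (1 / 2) (k - j)) *
        ‖mFourierCoeff (EuclideanSpace.complexify ∘ v) (k - j)‖ₑ *
        ‖mFourierCoeff (EuclideanSpace.complexify ∘ v) j‖ₑ := by
  refine (enorm_le_sum_enorm_apply _).trans ?_
  calc ∑ l, ‖mFourierCoeff (EuclideanSpace.complexify ∘ Torus.convect v v) k l‖ₑ
      ≤ ∑ _l : d, (Fintype.card d : ℝ≥0∞) * ∑' j, ENNReal.ofReal (fracSymbol (1 / 2) (k - j)) *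
          ‖mFourierCoeff (EuclideanSpace.complexify ∘ v) (k - j)‖ₑ *
          ‖mFourierCoeff (EuclideanSpace.complexify ∘ v) j‖ₑ :=
        Finset.sum_le_sum fun l _ => enorm_mFourierCoeff_convect_apply_le hv k l
    _ = _ := by rw [Finset.sum_const, Finset.card_univ, nsmul_eq_mul, sq, mul_assoc]

/-! ## 3. The pairing in Fourier variables -/

omit [DecidableEq d] in
/-- `‖σ Re⟪z, w⟫‖ₑ ≤ σ ‖z‖ₑ ‖w‖ₑ` for `σ ≥ 0`. [folklore] -/
theorem enorm_mul_re_inner_le {σ : ℝ} (hσ : 0 ≤ σ) (z w : EuclideanSpace ℂ d) :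
    ‖σ * (⟪z, w⟫_ℂ).re‖ₑ ≤ ENNReal.ofReal σ * ‖z‖ₑ * ‖w‖ₑ := by
  rw [← ofReal_norm, ← ofReal_norm z, ← ofReal_norm w, ← ENNReal.ofReal_mul hσ,
    ← ENNReal.ofReal_mul (mul_nonneg hσ (norm_nonneg _))]
  refine ENNReal.ofReal_le_ofReal ?_
  rw [norm_mul, Real.norm_eq_abs, abs_of_nonneg hσ, mul_assoc]
  exact mul_le_mul_of_nonneg_left ((Complex.abs_re_le_norm _).trans (norm_inner_le_norm _ _)) hσ

/-- **The pairing of the inertial rate, majorised in `ℝ≥0∞`**: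
`ofReal |∫⟪(-Δ)^s v, (v·∇)v⟫| ≤ ∑_k σ_s(k) ‖𝓕((v·∇)v)(k)‖ ‖v̂(k)‖` (`s ≥ 0`, smooth `v`). [folklore] -/
theorem ofReal_abs_integral_inner_fracLaplacian_convect_le {s : ℝ} (hs : 0 ≤ s)
    {v : UnitAddTorus d → EuclideanSpace ℝ d} (hv : IsSmooth v) :
    ENNReal.ofReal |∫ x, ⟪fracLaplacian s v x, Torus.convect v v x⟫_ℝ| ≤
      ∑' k, ENNReal.ofReal (fracSymbol s k) *
        ‖mFourierCoeff (EuclideanSpace.complexify ∘ Torus.convect v v) k‖ₑ *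
        ‖mFourierCoeff (EuclideanSpace.complexify ∘ v) k‖ₑ := by
  have hw : IsSmooth (Torus.convect v v) := hv.convect hv
  have h1 : (fun x => ⟪fracLaplacian s v x, Torus.convect v v x⟫_ℝ) =
      fun x => ⟪Torus.convect v v x, fracLaplacian s v x⟫_ℝ := funext fun x => real_inner_comm _ _
  rw [h1, integral_inner_fracLaplacian_eq_tsum hs hv hw.continuous, ← Real.enorm_eq_ofReal_abs]
  refine enorm_tsum_le_tsum_enorm.trans (ENNReal.tsum_le_tsum fun k => ?_)
  exact enorm_mul_re_inner_le (fracSymbol_nonneg s k) _ _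

/-! ## 4. The energies as `ℝ≥0∞` sums -/

/-- `ofReal (E_t(v)) = ∑_m σ_t(m) ‖v̂(m)‖ₑ²` for smooth `v`, `t ≥ 0`. [folklore] -/
theorem ofReal_torusHsEnergy_eq_tsum {t : ℝ} (ht : 0 ≤ t) {v : UnitAddTorus d → EuclideanSpace ℝ d}
    (hv : IsSmooth v) :
    ENNReal.ofReal (torusHsEnergy t v) =
      ∑' m, ENNReal.ofReal (fracSymbol t m) * ‖mFourierCoeff (EuclideanSpace.complexify ∘ v) m‖ₑ ^ 2 := by
  rw [torusHsEnergy_eq_tsum ht hv, ENNReal.ofReal_tsum_of_nonneg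
    (fun m => mul_nonneg (fracSymbol_nonneg t m) (sq_nonneg _)) (summable_hsSymbolSum_term t hv)]
  refine tsum_congr fun m => ?_
  rw [ENNReal.ofReal_mul (fracSymbol_nonneg t m), ENNReal.ofReal_pow (norm_nonneg _), ofReal_norm]

omit [DecidableEq d] in
/-- Reweighting off the zero mode: if `φ(m) = ψ(m)` for `m ≠ 0` and `v̂(0) = 0`, the weighted sums of
`‖v̂‖²·X` agree. [folklore] -/
theorem tsum_ofReal_mul_congr_of_zero {φ ψ : (d → ℤ) → ℝ} (h : ∀ m, m ≠ 0 → φ m = ψ m)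
    {c : (d → ℤ) → EuclideanSpace ℂ d} (hc : c 0 = 0) (X : (d → ℤ) → ℝ≥0∞) :
    ∑' m, ENNReal.ofReal (φ m) * (X m * ‖c m‖ₑ ^ 2) = ∑' m, ENNReal.ofReal (ψ m) * (X m * ‖c m‖ₑ ^ 2) := by
  refine tsum_congr fun m => ?_
  by_cases hm : m = 0
  · rw [hm, hc, enorm_zero, zero_pow two_ne_zero, mul_zero, mul_zero, mul_zero]
  · rw [h m hm]

/-! ## 5. The trilinear bound of the inertial rate -/

/-- **`N_s(v)² ≤ C · E_{t₁+1}(v) E_{t₂}(v) E_{t₃+2s}(v)`** on a three-dimensional torus, for every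
smooth zero-mean field `v`, whenever `t₁, t₂, t₃ < 3/2`, `t₁ + t₂ + t₃ = 3/2`, `s > 0` and
`t₁ + 1, t₂, t₃ + 2s ≥ 0` (`C` depends on the exponents only): the lattice trilinear estimate
`LatticeTrilinear.sq_tsum_tsum_conv_mul_le` with `a = σ_{1/2}‖v̂‖`, `b = ‖v̂‖`, `c = σ_s‖v̂‖`, fed by
`|N_s| ≤ 2∑_k σ_s‖𝓕((v·∇)v)(k)‖‖v̂(k)‖` and the Fourier majorant of the convective term. This is
the static half of the rows `EF.s | T_LD | G1` before interpolation. [ours] -/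
theorem sq_hsInertialRate_le_trilinear (hd : Fintype.card d = 3) {t₁ t₂ t₃ : ℝ} (ht₁ : t₁ < 3 / 2)
    (ht₂ : t₂ < 3 / 2) (ht₃ : t₃ < 3 / 2) (hsum : t₁ + t₂ + t₃ = 3 / 2) {s : ℝ} (hs : 0 < s)
    (h₁ : 0 ≤ t₁ + 1) (h₂ : 0 ≤ t₂) (h₃ : 0 ≤ t₃ + 2 * s) :
    ∃ C : ℝ, 0 ≤ C ∧ ∀ v : UnitAddTorus d → EuclideanSpace ℝ d, IsSmooth v → HasZeroMean v →
      hsInertialRate s v ^ 2 ≤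
        C * (torusHsEnergy (t₁ + 1) v * torusHsEnergy t₂ v * torusHsEnergy (t₃ + 2 * s) v) := by
  obtain ⟨K, hK, hT⟩ := LatticeTrilinear.sq_tsum_tsum_conv_mul_le hd ht₁ ht₂ ht₃ hsum
  refine ⟨4 * (Fintype.card d : ℝ) ^ 4 * K, by positivity, fun v hv h0 => ?_⟩
  -- names
  set cv : (d → ℤ) → EuclideanSpace ℂ d := fun m => mFourierCoeff (EuclideanSpace.complexify ∘ v) m with hcv
  set cw : (d → ℤ) → EuclideanSpace ℂ d :=
    fun m => mFourierCoeff (EuclideanSpace.complexify ∘ Torus.convect v v) m with hcw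
  have hcv0 : cv 0 = 0 := mFourierCoeff_complexify_eq_zero_of_hasZeroMean h0
  set A₁ : (d → ℤ) → ℝ≥0∞ := fun m => ENNReal.ofReal (fracSymbol (1 / 2) m) * ‖cv m‖ₑ with hA₁
  set A₂ : (d → ℤ) → ℝ≥0∞ := fun m => ‖cv m‖ₑ with hA₂
  set A₃ : (d → ℤ) → ℝ≥0∞ := fun m => ENNReal.ofReal (fracSymbol s m) * ‖cv m‖ₑ with hA₃
  have hA₁0 : A₁ 0 = 0 := by simp [hA₁, hcv0]
  have hA₂0 : A₂ 0 = 0 := by simp [hA₂, hcv0]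
  have hA₃0 : A₃ 0 = 0 := by simp [hA₃, hcv0]
  set T : ℝ≥0∞ := ∑' k : d → ℤ, ∑' j : d → ℤ, A₁ (k - j) * A₂ j * A₃ k with hTdef
  set E₁ := torusHsEnergy (t₁ + 1) v with hE₁
  set E₂ := torusHsEnergy t₂ v with hE₂
  set E₃ := torusHsEnergy (t₃ + 2 * s) v with hE₃
  have hE₁0 : 0 ≤ E₁ := torusHsEnergy_nonneg h₁ hv
  have hE₂0 : 0 ≤ E₂ := torusHsEnergy_nonneg h₂ hv
  have hE₃0 : 0 ≤ E₃ := torusHsEnergy_nonneg h₃ hv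
  -- ### (i) `ofReal |N_s| ≤ 2 d² T`
  have hN : ENNReal.ofReal |hsInertialRate s v| ≤ 2 * ((Fintype.card d : ℝ≥0∞) ^ 2 * T) := by
    have hP := ofReal_abs_integral_inner_fracLaplacian_convect_le hs.le hv
    unfold hsInertialRate
    rw [abs_mul, abs_neg, abs_two, ENNReal.ofReal_mul zero_le_two, ENNReal.ofReal_ofNat]
    refine mul_le_mul' le_rfl (hP.trans ?_)
    calc ∑' k, ENNReal.ofReal (fracSymbol s k) * ‖cw k‖ₑ * ‖cv k‖ₑ
        ≤ ∑' k, ENNReal.ofReal (fracSymbol s k) * ((Fintype.card d : ℝ≥0∞) ^ 2 *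
            ∑' j, ENNReal.ofReal (fracSymbol (1 / 2) (k - j)) * ‖cv (k - j)‖ₑ * ‖cv j‖ₑ) * ‖cv k‖ₑ :=
          ENNReal.tsum_le_tsum fun k => mul_le_mul' (mul_le_mul' le_rfl (enorm_mFourierCoeff_convect_le hv k)) le_rfl
      _ = (Fintype.card d : ℝ≥0∞) ^ 2 * T := by
          rw [hTdef, ← ENNReal.tsum_mul_left]
          refine tsum_congr fun k => ?_
          rw [ENNReal.tsum_mul_right]
          simp only [hA₁, hA₂, hA₃]
          ring
  -- ### (ii) the trilinear estimate and the three energies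
  have hTT : T ^ 2 ≤ ENNReal.ofReal K * ENNReal.ofReal E₁ * ENNReal.ofReal E₂ * ENNReal.ofReal E₃ := by
    have h := hT A₁ A₂ A₃ hA₁0 hA₂0 hA₃0
    have e₁ : ∑' m, ENNReal.ofReal (fracSymbol t₁ m) * A₁ m ^ 2 = ENNReal.ofReal E₁ := by
      rw [hE₁, ofReal_torusHsEnergy_eq_tsum h₁ hv]
      have step : ∀ m, ENNReal.ofReal (fracSymbol t₁ m) * A₁ m ^ 2 =
          ENNReal.ofReal (fracSymbol t₁ m * fracSymbol (1 / 2) m ^ 2) * (1 * ‖cv m‖ₑ ^ 2) := by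
        intro m
        rw [hA₁]; dsimp only
        rw [mul_pow, ← ENNReal.ofReal_pow (fracSymbol_nonneg _ _), ENNReal.ofReal_mul (fracSymbol_nonneg _ _)]
        ring
      rw [tsum_congr step, tsum_ofReal_mul_congr_of_zero (ψ := fun m => fracSymbol (t₁ + 1) m) ?_ hcv0]
      · exact tsum_congr fun m => by rw [one_mul]
      · intro m hm
        rw [LatticeTrilinear.fracSymbol_add_of_ne_zero hm, LatticeTrilinear.fracSymbol_eq_rpow (1 / 2),
          ← Real.rpow_natCast, ← Real.rpow_mul (fracSymbol_nonneg 1 m)]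
        norm_num
    have e₂ : ∑' m, ENNReal.ofReal (fracSymbol t₂ m) * A₂ m ^ 2 = ENNReal.ofReal E₂ := by
      rw [hE₂, ofReal_torusHsEnergy_eq_tsum h₂ hv]
    have e₃ : ∑' m, ENNReal.ofReal (fracSymbol t₃ m) * A₃ m ^ 2 = ENNReal.ofReal E₃ := by
      rw [hE₃, ofReal_torusHsEnergy_eq_tsum h₃ hv]
      have step : ∀ m, ENNReal.ofReal (fracSymbol t₃ m) * A₃ m ^ 2 =
          ENNReal.ofReal (fracSymbol t₃ m * fracSymbol s m ^ 2) * (1 * ‖cv m‖ₑ ^ 2) := by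
        intro m
        rw [hA₃]; dsimp only
        rw [mul_pow, ← ENNReal.ofReal_pow (fracSymbol_nonneg _ _), ENNReal.ofReal_mul (fracSymbol_nonneg _ _)]
        ring
      rw [tsum_congr step, tsum_ofReal_mul_congr_of_zero (ψ := fun m => fracSymbol (t₃ + 2 * s) m) ?_ hcv0]
      · exact tsum_congr fun m => by rw [one_mul]
      · intro m hm
        rw [LatticeTrilinear.fracSymbol_add_of_ne_zero hm, LatticeTrilinear.fracSymbol_eq_rpow s,
          LatticeTrilinear.fracSymbol_eq_rpow (2 * s), ← Real.rpow_natCast,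
          ← Real.rpow_mul (fracSymbol_nonneg 1 m)]
        congr 2
        push_cast
        ring
    rw [e₁, e₂, e₃] at h
    exact h
  -- ### (iii) assemble in `ℝ≥0∞` and return to `ℝ`
  have hfin : ENNReal.ofReal (hsInertialRate s v ^ 2) ≤
      ENNReal.ofReal (4 * (Fintype.card d : ℝ) ^ 4 * K * (E₁ * E₂ * E₃)) := by
    have hd2 : ((Fintype.card d : ℝ≥0∞) ^ 2) ^ 2 = ENNReal.ofReal ((Fintype.card d : ℝ) ^ 4) := by
      rw [← pow_mul, ENNReal.ofReal_pow (Nat.cast_nonneg _), ENNReal.ofReal_natCast]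
    calc ENNReal.ofReal (hsInertialRate s v ^ 2) = ENNReal.ofReal |hsInertialRate s v| ^ 2 := by
          rw [← ENNReal.ofReal_pow (abs_nonneg _), sq_abs]
      _ ≤ (2 * ((Fintype.card d : ℝ≥0∞) ^ 2 * T)) ^ 2 := pow_le_pow_left' hN 2
      _ = 4 * ((Fintype.card d : ℝ≥0∞) ^ 2) ^ 2 * T ^ 2 := by ring
      _ ≤ 4 * ((Fintype.card d : ℝ≥0∞) ^ 2) ^ 2 *
            (ENNReal.ofReal K * ENNReal.ofReal E₁ * ENNReal.ofReal E₂ * ENNReal.ofReal E₃) :=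
          mul_le_mul' le_rfl hTT
      _ = ENNReal.ofReal (4 * (Fintype.card d : ℝ) ^ 4 * K * (E₁ * E₂ * E₃)) := by
          have h4 : (0 : ℝ) ≤ 4 := by norm_num
          have hc4 : (0 : ℝ) ≤ 4 * (Fintype.card d : ℝ) ^ 4 := by positivity
          have hK1 : 0 ≤ K * E₁ := mul_nonneg hK hE₁0
          have hK2 : 0 ≤ K * E₁ * E₂ := mul_nonneg hK1 hE₂0
          rw [hd2, show (4 : ℝ≥0∞) = ENNReal.ofReal 4 by norm_num, ← ENNReal.ofReal_mul h4,
            ← ENNReal.ofReal_mul hK, ← ENNReal.ofReal_mul hK1, ← ENNReal.ofReal_mul hK2, ← ENNReal.ofReal_mul hc4]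
          congr 1
          ring
  exact (ENNReal.ofReal_le_ofReal_iff (by positivity)).1 hfin

end Summit.NavierStokesRegularity.FunctionalMining
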